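import Literature.Computability.AlgebraicComplexity.BCGPUInfiniteGroups
import Literature.Computability.AlgebraicComplexity.CohnUmansTPPProofs
import Literature.Computability.AlgebraicComplexity.MatMulMonomialSubrank
import HarnessLib

/-!
# BCGPU 2024, Theorem 2.2 (matrix multiplication algorithms from the TPP in infinite groups):
# the corrected statement, proved

Topic `Literature/Computability/AlgebraicComplexity`; sibling of `BCGPUInfiniteGroups.lean`, which
vendors Def. 2.1 (`IsSeparatingFamily`), `RepFun` (`repFun`) and the named fact `BCGPU2024_thm_2_2`
of J. Blasiak, H. Cohn, J. A. Grochow, K. Pratt, C. Umans, *Finite matrix multiplication algorithms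
from infinite groups*, arXiv:2410.14905 (ITCS 2025), Thm. 2.2 (p. 11):

"Let `G` be a group (not necessarily finite), with finite subsets `X, Y, Z` satisfying the TPP. If
`R_sep` is a finite set of finite-dimensional complex representations of `G` such that
`RepFun(R_sep)` contains a set of separating functions for `(X, Y, Z)`, then
`(|X| |Y| |Z|)^{ω/3} ≤ ∑_{ρ ∈ R_sep} (dim ρ)^ω`."

## The statement needs the TPP in *embedding form* (why `BCGPU2024_thm_2_2` is not proved here)

The source defines the TPP (§1, p. 2) in the right-quotient form of Cohn–Umans 2003, Def. 2.1 —
"`x x'⁻¹ y y'⁻¹ z z'⁻¹ = 1 ⟺ x = x', y = y', z = z'`" — which is the tree's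
`TripleProductProperty`, and `BCGPU2024_thm_2_2` renders Thm. 2.2 with exactly that hypothesis.
The printed proof (pp. 12–13), however, rests on eq. (2.1) (p. 10): with `Ā = ∑ A[x,y] (x y⁻¹)`,
`B̄ = ∑ B[y,z] (y z⁻¹)`, "the TPP implies that `Ā · B̄ = ∑_{x,z} (AB)[x,z] (x z⁻¹) + E` where `E`
is supported on `X Y⁻¹ Y Z⁻¹ ∖ X Z⁻¹`", i.e. it uses the TPP in the EMBEDDING form matching
Def. 2.1: `x y⁻¹ y' z'⁻¹ = x₀ z₀⁻¹ ⟹ x = x₀, y = y', z' = z₀` for `x, x₀ ∈ X`, `y, y' ∈ Y`,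
`z', z₀ ∈ Z` (equivalently the LEFT-quotient TPP `x⁻¹x' · y⁻¹y' · z⁻¹z' = 1 ⟹ …`, the
right-quotient TPP of `(X⁻¹, Y⁻¹, Z⁻¹)`; Cohn–Umans 2003, Thm. 2.3 embed with `x⁻¹y`, `y⁻¹z`,
which IS consistent with right quotients). In a non-abelian group the two forms are not equivalent
for finite subsets, and Thm. 2.2 with the right-quotient TPP is false: in `S₃` take a reflection `b`,
a rotation `c` and `a = bc`, `X = {1, a}`, `Y = {1}`, `Z = {b, c}`; the right-quotient TPP holds,
`X Y⁻¹ Y Z⁻¹ = X Z⁻¹ = {b, c⁻¹}` has two elements told apart by the sign character, so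
`R_sep = {triv, sgn}` carries separating functions and Thm. 2.2 would give `4^{ω/3} ≤ 2`, against
`ω ≥ 2` — this refutation `¬ BCGPU2024_thm_2_2` is the sibling file
`BCGPUInfiniteGroupsCounterexample.lean`. The embedding form is also the one the source actually
verifies for its own constructions (proof of Lemma 2.11, p. 22: "Suppose … satisfy
`x₁(ε)⁻¹x₂(ε) y₁(ε)⁻¹y₂(ε) z₁(ε)⁻¹z₂(ε) = 1` … Equivalently, we have
`x₂(ε)y₁(ε)⁻¹y₂(ε)z₁(ε)⁻¹ = x₁(ε)z₂(ε)⁻¹`"), so only the sentence defining the TPP in §1 has the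
inverses on the other side; and the `MatrixMultiplication` route `NilpotentLieHosts` states its items
with the TPP in embedding form (`x * y⁻¹ * y' * z⁻¹ = x' * z'⁻¹ → x = x' ∧ y = y' ∧ z = z'`).

Accordingly this file vendors the CORRECTED statement `BCGPU2024_thm_2_2_corrected` — Thm. 2.2
verbatim except that "satisfying the TPP" is read in the embedding form its proof uses (spelled
exactly as in the route items) — and PROVES it (`BCGPU2024_thm_2_2_corrected_holds`), following the
printed proof:

1. `tensorRestrictsTo_structureTensor_of_factors` — a bilinear map computed inside an algebra with a
   finite basis (`s r p q = γ_r(α_p β_q)`) is a restriction of its structure tensor ("the summation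
   and inner product are linear functions … 'free' in a bilinear algorithm", p. 12; BCS 1997, §14.2);
2. `tensorRestrictsTo_matMulDirectSum_of_separating` — eq. (2.2): `α(x,y) = (ρ(x y⁻¹))_ρ`,
   `β(y,z) = (ρ(y z⁻¹))_ρ` in `⊕_ρ ℂ^{d_ρ×d_ρ}`, `γ_{x,z} = f̂_{x,z}` (coefficients of `f_{x,z}` in
   the matrix coefficients `ρ_{i,j}`) give `⟨|X|,|Y|,|Z|⟩ ≤ ⊕_ρ ⟨d_ρ,d_ρ,d_ρ⟩`
   ("`rk⟨|X|,|Y|,|Z|⟩ ≤ ∑_ρ rk⟨d_ρ,d_ρ,d_ρ⟩`", p. 12);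
3. `rpow_omega_le_sum_rpow_of_restrictsTo` — "by symmetrizing … and by the tensor power trick"
   (p. 13 = Cohn–Umans 2003, proof of Thm. 4.1): `⟨k,m,p⟩ ≤ ⊕ᵢ ⟨dᵢ,dᵢ,dᵢ⟩ ⟹ (kmp)^{ω/3} ≤ ∑ᵢ dᵢ^ω`,
   by the block calculus of `GroupAlgebraTensor.lean` and the two limit lemmas of
   `CohnUmansTPPProofs.lean` (verbatim the argument of `rpow_omega_le_sum_blockDegrees_rpow`);
4. zero-dimensional representations are dropped and the rest enumerated (`repFun_le_repFun_comp`):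
   `BCGPU2024_thm_2_2_corrected_holds`; the printed "In particular" clause is
   `BCGPU2024_thm_2_2_corrected.le_mul_rpow`.

## References

* [BlasiakCohnGrochowPrattUmans2024] J. Blasiak, H. Cohn, J. A. Grochow, K. Pratt, C. Umans,
  *Finite matrix multiplication algorithms from infinite groups*, arXiv:2410.14905: §1 p. 2 (TPP),
  §2.1 eq. (2.1) and Def. 2.1 (p. 10), Thm. 2.2 (p. 11), proof of Thm. 2.2 with eq. (2.2)
  (pp. 12–13).
* [CohnUmans2003] H. Cohn, C. Umans, FOCS 2003: Def. 2.1, Thm. 2.3, Thm. 4.1 (proof).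
* [BurgisserClausenShokrollahi1997] P. Bürgisser, M. Clausen, M. A. Shokrollahi, *Algebraic
  Complexity Theory* (1997), §14.2 (structural tensors, restriction).
-/

noncomputable section

open scoped BigOperators

namespace Literature.Computability.AlgebraicComplexity

universe u

/-! ## Bilinear maps computed inside an algebra are restrictions of its structure tensor -/

section Factor

variable {K : Type u} [CommSemiring K]

/-- **A bilinear map computed inside an algebra is a restriction of its structure tensor.** If a
coordinate tensor `s` satisfies `s r p q = γ_r (α_p · β_q)` for vectors `α_p, β_q` of a `K`-algebra
`A` with finite basis `E` and linear forms `γ_r` on `A`, then `s ≤ structureTensor E` (the matrices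
of the restriction are the coordinates of `α_p`, `β_q` and the values `γ_r(E_a)`; BCS 1997, §14.2,
and the source, p. 12: "The summation and inner product are linear functions whose coefficients are
independent of the input matrices `A, B`, so they are 'free' in a bilinear algorithm").
[cite: BlasiakCohnGrochowPrattUmans2024, Thm. 2.2 (proof, p. 12)] -/
theorem tensorRestrictsTo_structureTensor_of_factors {A : Type*} [Semiring A] [Algebra K A]
    {σ : Type*} [Fintype σ] (E : Module.Basis σ K A) {P Q R : Type*} (α : P → A) (β : Q → A)
    (γ : R → A →ₗ[K] K) (s : R → P → Q → K) (hs : ∀ r p q, s r p q = γ r (α p * β q)) :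
    TensorRestrictsTo (structureTensor E) s := by
  refine ⟨fun r a => γ r (E a), fun p b => E.repr (α p) b, fun q c => E.repr (β q) c,
    fun r p q => ?_⟩
  -- coordinates of the product `α p * β q` in the basis `E`
  have key : ∀ a, E.repr (α p * β q) a =
      ∑ b, ∑ c, E.repr (α p) b * E.repr (β q) c * structureTensor E a b c := by
    intro a
    conv_lhs => rw [← E.sum_repr (α p), ← E.sum_repr (β q)]
    rw [Finset.sum_mul_sum, map_sum, Finsupp.finsetSum_apply]
    refine Finset.sum_congr rfl fun b _ => ?_
    rw [map_sum, Finsupp.finsetSum_apply]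
    refine Finset.sum_congr rfl fun c _ => ?_
    rw [smul_mul_smul_comm, map_smul, Finsupp.smul_apply, smul_eq_mul, structureTensor_apply]
  rw [hs]
  conv_lhs => rw [← E.sum_repr (α p * β q)]
  rw [map_sum]
  refine Finset.sum_congr rfl fun a _ => ?_
  rw [map_smul, smul_eq_mul, key, Finset.sum_mul]
  refine Finset.sum_congr rfl fun b _ => ?_
  rw [Finset.sum_mul]
  refine Finset.sum_congr rfl fun c _ => ?_
  ring

end Factor

/-! ## `⟨k, m, p⟩ ≤ ⊕ᵢ ⟨dᵢ, dᵢ, dᵢ⟩` implies `(kmp)^{ω/3} ≤ ∑ᵢ dᵢ^ω` -/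

section Blocks

variable {r : ℕ} (d : Fin r → ℕ) [∀ i, NeZero (d i)]

/-- Rank form of the `N`-th tensor power of a restriction `⟨k,m,p⟩ ≤ ⊕ᵢ ⟨dᵢ,dᵢ,dᵢ⟩`:
`R(⟨k^N, m^N, p^N⟩) ≤ ∑_{J : Fin N → Fin r} R(⟨∏ₗ d_{J l}, ∏ₗ d_{J l}, ∏ₗ d_{J l}⟩)`
(`⟨k^N,m^N,p^N⟩ ≅ ⟨k,m,p⟩^{⊗N} ≤ (⊕ᵢ ⟨dᵢ⟩)^{⊗N} = ⊕_J ⊗ₗ ⟨d_{J l}⟩`; Cohn–Umans 2003, proof of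
Thm. 4.1, "taking the rank of both sides"). [cite: CohnUmans2003, Thm. 4.1 (proof)] -/
theorem tensorRank_matMulTensor_pow_le_of_restrictsTo {k m p : ℕ}
    (h : TensorRestrictsTo (matMulDirectSum ℂ d d d) (matMulTensor ℂ k m p)) (N : ℕ) :
    tensorRank (matMulTensor ℂ (k ^ N) (m ^ N) (p ^ N)) ≤
      ∑ J : Fin N → Fin r,
        tensorRank (matMulTensor ℂ (∏ l, d (J l)) (∏ l, d (J l)) (∏ l, d (J l))) := by
  have h1 : TensorRestrictsTo (kroneckerPow (matMulTensor ℂ k m p) N)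
      (matMulTensor ℂ (k ^ N) (m ^ N) (p ^ N)) := by
    rw [matMulTensor_pow_eq_kroneckerPow_comp ℂ k m p N]
    exact tensorRestrictsTo_precomp _ _ _ _
  calc tensorRank (matMulTensor ℂ (k ^ N) (m ^ N) (p ^ N))
      ≤ tensorRank (kroneckerPow (matMulTensor ℂ k m p) N) := h1.tensorRank_le
    _ ≤ tensorRank (kroneckerPow (matMulDirectSum ℂ d d d) N) := (h.kroneckerPow N).tensorRank_le
    _ = tensorRank (∑ J : Fin N → Fin r, blockPiTensor ℂ d J) := by
      rw [kroneckerPow_matMulDirectSum]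
    _ ≤ ∑ J : Fin N → Fin r, tensorRank (blockPiTensor ℂ d J) := tensorRank_sum_le _ _
    _ ≤ _ := Finset.sum_le_sum fun J _ => tensorRank_blockPiTensor_le ℂ d J

/-- **`⟨k, m, p⟩ ≤ ⊕ᵢ ⟨dᵢ, dᵢ, dᵢ⟩ ⟹ (kmp)^{ω/3} ≤ ∑ᵢ dᵢ^ω`** (`dᵢ ≥ 1`, at least one block): the
"symmetrizing" and "tensor power trick" step of the source (p. 13) = Cohn–Umans 2003, proof of
Thm. 4.1: `(kmp)^{Nω/3} ≤ R(⟨k^N,m^N,p^N⟩) ≤ ∑_J R(⟨∏ d_{J l},…⟩) ≤ C (∑ᵢ dᵢ^{ω+ε})^N`, then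
`N → ∞` and `ε → 0`. [cite: BlasiakCohnGrochowPrattUmans2024, Thm. 2.2 (proof, p. 13)] -/
theorem rpow_omega_le_sum_rpow_of_restrictsTo (hr : 0 < r) {k m p : ℕ}
    (h : TensorRestrictsTo (matMulDirectSum ℂ d d d) (matMulTensor ℂ k m p)) :
    ((k * m * p : ℕ) : ℝ) ^ (omega ℂ / 3) ≤ ∑ i, (d i : ℝ) ^ omega ℂ := by
  have hω0 : 0 < omega ℂ := zero_lt_two.trans_le (omega_two_le (K := ℂ))
  have hd : ∀ i, (0 : ℝ) < d i := fun i => by exact_mod_cast Nat.pos_of_ne_zero (NeZero.ne _)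
  rcases Nat.eq_zero_or_pos (k * m * p) with hq | hq
  · rw [hq, Nat.cast_zero, Real.zero_rpow (div_pos hω0 three_pos).ne']
    exact Finset.sum_nonneg fun i _ => Real.rpow_nonneg (Nat.cast_nonneg _) _
  refine le_of_forall_pos_le_sum_rpow hd fun ε hε => ?_
  obtain ⟨C, -, hCk⟩ := exists_tensorRank_matMulTensor_le_rpow ℂ hε
  have hb : 0 < ∑ i, (d i : ℝ) ^ (omega ℂ + ε) := by
    have hne : (Finset.univ : Finset (Fin r)).Nonempty := ⟨⟨0, hr⟩, Finset.mem_univ _⟩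
    exact Finset.sum_pos (fun i _ => Real.rpow_pos_of_pos (hd i) _) hne
  refine le_of_pow_le_mul_pow (C := C) hb fun N => ?_
  have hDJ : ∀ J : Fin N → Fin r, 1 ≤ ∏ l, d (J l) := fun J =>
    Finset.prod_pos fun l _ => Nat.pos_of_ne_zero (NeZero.ne _)
  have hqN : 1 ≤ k ^ N * m ^ N * p ^ N := by
    rw [← mul_pow, ← mul_pow]; exact Nat.one_le_pow _ _ hq
  have hx : (0 : ℝ) ≤ ((k * m * p : ℕ) : ℝ) := Nat.cast_nonneg _
  have hcast : ((k ^ N * m ^ N * p ^ N : ℕ) : ℝ) = ((k * m * p : ℕ) : ℝ) ^ N := by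
    push_cast
    ring
  have hpow : (((k * m * p : ℕ) : ℝ) ^ N) ^ (omega ℂ / 3) =
      (((k * m * p : ℕ) : ℝ) ^ (omega ℂ / 3)) ^ N := by
    rw [← Real.rpow_natCast ((k * m * p : ℕ) : ℝ) N,
      ← Real.rpow_natCast (((k * m * p : ℕ) : ℝ) ^ (omega ℂ / 3)) N, ← Real.rpow_mul hx,
      ← Real.rpow_mul hx, mul_comm (N : ℝ)]
  have step1 : (((k * m * p : ℕ) : ℝ) ^ (omega ℂ / 3)) ^ N ≤
      tensorRank (matMulTensor ℂ (k ^ N) (m ^ N) (p ^ N)) := by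
    have := rpow_omega_div_three_le_tensorRank ℂ hqN
    rwa [hcast, hpow] at this
  have step2 : (tensorRank (matMulTensor ℂ (k ^ N) (m ^ N) (p ^ N)) : ℝ) ≤
      ∑ J : Fin N → Fin r, (tensorRank (matMulTensor ℂ (∏ l, d (J l)) (∏ l, d (J l))
        (∏ l, d (J l))) : ℝ) := by
    exact_mod_cast tensorRank_matMulTensor_pow_le_of_restrictsTo d h N
  have step3 : ∀ J : Fin N → Fin r,
      (tensorRank (matMulTensor ℂ (∏ l, d (J l)) (∏ l, d (J l)) (∏ l, d (J l))) : ℝ) ≤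
        C * ∏ l, (d (J l) : ℝ) ^ (omega ℂ + ε) := fun J => by
    refine (hCk _ (hDJ J)).trans_eq ?_
    rw [Nat.cast_prod, Real.finsetProd_rpow _ _ fun l _ => (hd (J l)).le]
  calc (((k * m * p : ℕ) : ℝ) ^ (omega ℂ / 3)) ^ N
      ≤ ∑ J : Fin N → Fin r, C * ∏ l, (d (J l) : ℝ) ^ (omega ℂ + ε) :=
        step1.trans (step2.trans (Finset.sum_le_sum fun J _ => step3 J))
    _ = C * (∑ i, (d i : ℝ) ^ (omega ℂ + ε)) ^ N := by
        rw [← Finset.mul_sum, Fintype.sum_pow]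

end Blocks

/-! ## Eq. (2.2): `⟨|X|,|Y|,|Z|⟩ ≤ ⊕ᵢ ⟨dᵢ,dᵢ,dᵢ⟩` from separating functions in `RepFun` -/

section Embedding

variable {G : Type u} [Group G]

/-- The matrix-coefficient functions `ρ_{a,b} : g ↦ (ρᵢ g)_{ab}` of a family of matrix
representations, indexed by the block index `(i, a, b)` (source, p. 12: "let `ρ_{i,j}(g)` be the
`(i, j)` entry of the matrix `ρ(g)`, which we think of as a function `ρ_{i,j} : G → ℂ`").
[cite: BlasiakCohnGrochowPrattUmans2024, Thm. 2.2 (proof, p. 12)] -/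
def matrixCoeffFun {r : ℕ} (d : Fin r → ℕ)
    (ρ : ∀ i, G →* Matrix.GeneralLinearGroup (Fin (d i)) ℂ) (k : BlockIndex d) (g : G) : ℂ :=
  ((ρ k.1 g : Matrix.GeneralLinearGroup (Fin (d k.1)) ℂ) : Matrix (Fin (d k.1)) (Fin (d k.1)) ℂ)
    k.2.1 k.2.2

/-- `RepFun(R_sep)` is the span of the finitely many matrix-coefficient functions `ρ_{a,b}`.
[cite: BlasiakCohnGrochowPrattUmans2024, §2.1 (RepFun, p. 11)] -/
theorem repFun_eq_span_range {r : ℕ} (d : Fin r → ℕ)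
    (ρ : ∀ i, G →* Matrix.GeneralLinearGroup (Fin (d i)) ℂ) :
    repFun d ρ = Submodule.span ℂ (Set.range (matrixCoeffFun d ρ)) := by
  unfold repFun
  congr 1
  ext φ
  simp only [Set.mem_setOf_eq, Set.mem_range]
  constructor
  · rintro ⟨i, a, b, rfl⟩
    exact ⟨⟨i, (a, b)⟩, rfl⟩
  · rintro ⟨⟨i, a, b⟩, rfl⟩
    exact ⟨i, a, b, rfl⟩

/-- Dropping or relabelling representations: if every index carrying a representation of nonzero
dimension is in the image of `e : κ → ι`, then `RepFun` of the family does not exceed `RepFun` of the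
reindexed family `(ρ_{e k})_k` (zero-dimensional representations have no matrix coefficients).
[cite: BlasiakCohnGrochowPrattUmans2024, §2.1 (RepFun, p. 11)] -/
theorem repFun_le_repFun_comp {ι κ : Type*} (n : ι → ℕ)
    (ρ : ∀ i, G →* Matrix.GeneralLinearGroup (Fin (n i)) ℂ) (e : κ → ι)
    (he : ∀ i, n i ≠ 0 → ∃ k, e k = i) :
    repFun n ρ ≤ repFun (n ∘ e) (fun k => ρ (e k)) := by
  refine Submodule.span_mono ?_
  rintro φ ⟨i, a, b, rfl⟩
  obtain ⟨k, rfl⟩ := he i (Fin.pos a).ne'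
  exact ⟨k, a, b, rfl⟩

/-- **Eq. (2.2) of the source as a tensor restriction: `⟨|X|, |Y|, |Z|⟩ ≤ ⊕ᵢ ⟨dᵢ, dᵢ, dᵢ⟩`.**
Under the triple product property in embedding form and with separating functions
`f_{x,z} ∈ RepFun(R_sep)`, the matrix multiplication tensor with rows `X`, inner indices `Y` and
columns `Z` is a restriction of the structure tensor `⊕ᵢ ⟨dᵢ,dᵢ,dᵢ⟩` of `⊕ᵢ ℂ^{dᵢ×dᵢ}`: with
`α(x,y) = (ρᵢ(x y⁻¹))ᵢ`, `β(y,z) = (ρᵢ(y z⁻¹))ᵢ` and `γ_{x,z} = f̂_{x,z}` (coefficients of `f_{x,z}`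
in the `ρ_{a,b}`), "`(AB)[x,z] = f_{x,z}(Ā · B̄) = ∑_ρ ⟨f̂_{x,z}(ρ), ρ(Ā) · ρ(B̄)⟩`" — here entrywise:
`γ_{x,z}(α(x',y) β(y',z')) = f_{x,z}(x' y⁻¹ y' z'⁻¹) = [x = x' ∧ y = y' ∧ z = z']` by Def. 2.1 and
the TPP. [cite: BlasiakCohnGrochowPrattUmans2024, Thm. 2.2 (proof, eq. (2.2), p. 12)] -/
theorem tensorRestrictsTo_matMulDirectSum_of_separating [DecidableEq G] (X Y Z : Finset G)
    (hTPP : ∀ x ∈ X, ∀ x' ∈ X, ∀ y ∈ Y, ∀ y' ∈ Y, ∀ z ∈ Z, ∀ z' ∈ Z,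
      x * y⁻¹ * y' * z⁻¹ = x' * z'⁻¹ → x = x' ∧ y = y' ∧ z = z')
    {r : ℕ} (d : Fin r → ℕ) (ρ : ∀ i, G →* Matrix.GeneralLinearGroup (Fin (d i)) ℂ)
    (f : G → G → G → ℂ) (hf : IsSeparatingFamily X Y Z f)
    (hmem : ∀ x ∈ X, ∀ z ∈ Z, f x z ∈ repFun d ρ) :
    TensorRestrictsTo (matMulDirectSum ℂ d d d) (matMulTensorOn ℂ X Y Z) := by
  -- `f̂_{x,z}`: coefficients of the separating functions in the matrix coefficients
  have hM : ∀ w : X × Z, ∃ M : BlockIndex d → ℂ,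
      ∑ k, M k • matrixCoeffFun d ρ k = f w.1 w.2 := fun w => by
    have h := hmem w.1 w.1.2 w.2 w.2.2
    rw [repFun_eq_span_range] at h
    exact (Submodule.mem_span_range_iff_exists_fun ℂ).1 h
  choose M hM using hM
  let α : X × Y → BlockAlgebra ℂ d := fun v i =>
    ((ρ i ((v.1 : G) * (v.2 : G)⁻¹) : Matrix.GeneralLinearGroup (Fin (d i)) ℂ) :
      Matrix (Fin (d i)) (Fin (d i)) ℂ)
  let β : Y × Z → BlockAlgebra ℂ d := fun v i =>
    ((ρ i ((v.1 : G) * (v.2 : G)⁻¹) : Matrix.GeneralLinearGroup (Fin (d i)) ℂ) :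
      Matrix (Fin (d i)) (Fin (d i)) ℂ)
  let γ : X × Z → BlockAlgebra ℂ d →ₗ[ℂ] ℂ := fun w =>
    { toFun := fun A => ∑ k : BlockIndex d, M w k * A k.1 k.2.1 k.2.2
      map_add' := fun A B => by
        simp only [Pi.add_apply, Matrix.add_apply, mul_add, Finset.sum_add_distrib]
      map_smul' := fun c A => by
        simp only [Pi.smul_apply, Matrix.smul_apply, smul_eq_mul, RingHom.id_apply, Finset.mul_sum,
          mul_left_comm] }
  rw [← structureTensor_blockBasis_eq_matMulDirectSum]
  refine tensorRestrictsTo_structureTensor_of_factors (blockBasis ℂ d) α β γ _ fun w u v => ?_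
  obtain ⟨⟨x, hx⟩, ⟨z, hz⟩⟩ := w
  obtain ⟨⟨x', hx'⟩, ⟨y, hy⟩⟩ := u
  obtain ⟨⟨y', hy'⟩, ⟨z', hz'⟩⟩ := v
  have hγ : γ (⟨x, hx⟩, ⟨z, hz⟩) (α (⟨x', hx'⟩, ⟨y, hy⟩) * β (⟨y', hy'⟩, ⟨z', hz'⟩)) =
      f x z (x' * y⁻¹ * y' * z'⁻¹) := by
    have e := congrFun (hM (⟨x, hx⟩, ⟨z, hz⟩)) (x' * y⁻¹ * y' * z'⁻¹)
    rw [Finset.sum_apply] at e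
    simp only [Pi.smul_apply, smul_eq_mul] at e
    show ∑ k : BlockIndex d, M _ k * (α _ * β _) k.1 k.2.1 k.2.2 = _
    rw [← e]
    refine Finset.sum_congr rfl fun k _ => ?_
    congr 1
    simp only [α, β, matrixCoeffFun, Pi.mul_apply, ← Units.val_mul, ← map_mul, mul_assoc]
  rw [hγ, matMulTensorOn_apply]
  simp only [Subtype.mk.injEq]
  by_cases heq : x' * y⁻¹ * y' * z'⁻¹ = x * z⁻¹
  · obtain ⟨h1, h2, h3⟩ := hTPP x' hx' x hx y hy y' hy' z' hz' z hz heq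
    rw [heq, (hf x hx z hz).1, if_pos ⟨h1.symm, h2, h3.symm⟩]
  · rw [(hf x hx z hz).2 x' hx' y hy y' hy' z' hz' heq, if_neg]
    rintro ⟨rfl, rfl, rfl⟩
    exact heq (by group)

end Embedding

/-! ## The corrected Theorem 2.2 -/

section Main

/-- **Thm. 2.2 for a family `(ρᵢ)_{i<r}` of representations of dimensions `dᵢ ≥ 1`**, TPP in
embedding form: `(|X||Y||Z|)^{ω/3} ≤ ∑ᵢ dᵢ^ω` (eq. (2.2) + the tensor power trick; if `|X||Y||Z| ≥ 1`
then some `f_{x,z} ≠ 0` lies in `RepFun`, so `r ≥ 1`). [cite: BlasiakCohnGrochowPrattUmans2024, Thm. 2.2] -/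
theorem card_rpow_omega_le_sum_rpow {G : Type u} [Group G] (X Y Z : Finset G)
    (hTPP : ∀ x ∈ X, ∀ x' ∈ X, ∀ y ∈ Y, ∀ y' ∈ Y, ∀ z ∈ Z, ∀ z' ∈ Z,
      x * y⁻¹ * y' * z⁻¹ = x' * z'⁻¹ → x = x' ∧ y = y' ∧ z = z')
    {r : ℕ} (d : Fin r → ℕ) [∀ i, NeZero (d i)]
    (ρ : ∀ i, G →* Matrix.GeneralLinearGroup (Fin (d i)) ℂ)
    (f : G → G → G → ℂ) (hf : IsSeparatingFamily X Y Z f)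
    (hmem : ∀ x ∈ X, ∀ z ∈ Z, f x z ∈ repFun d ρ) :
    ((X.card * Y.card * Z.card : ℕ) : ℝ) ^ (omega ℂ / 3) ≤ ∑ i, (d i : ℝ) ^ omega ℂ := by
  classical
  have hω0 : 0 < omega ℂ := zero_lt_two.trans_le (omega_two_le (K := ℂ))
  rcases Nat.eq_zero_or_pos (X.card * Y.card * Z.card) with hq | hq
  · rw [hq, Nat.cast_zero, Real.zero_rpow (div_pos hω0 three_pos).ne']
    exact Finset.sum_nonneg fun i _ => Real.rpow_nonneg (Nat.cast_nonneg _) _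
  -- `X`, `Z` are nonempty, so some `f x z ≠ 0` lies in `RepFun`, forcing `r ≥ 1`
  have hr : 0 < r := by
    rcases Nat.eq_zero_or_pos r with h0 | h0
    · exfalso
      subst h0
      have hX : X.Nonempty := Finset.card_pos.1 (Nat.pos_of_ne_zero fun h => by simp [h] at hq)
      have hZ : Z.Nonempty := Finset.card_pos.1 (Nat.pos_of_ne_zero fun h => by simp [h] at hq)
      obtain ⟨x, hx⟩ := hX
      obtain ⟨z, hz⟩ := hZ
      have hm := hmem x hx z hz
      haveI : IsEmpty (BlockIndex d) := ⟨fun k => Fin.elim0 k.1⟩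
      rw [repFun_eq_span_range, Set.range_eq_empty, Submodule.span_empty, Submodule.mem_bot] at hm
      have h1 := (hf x hx z hz).1
      rw [hm] at h1
      exact zero_ne_one h1
    · exact h0
  have hres := tensorRestrictsTo_matMulDirectSum_of_separating X Y Z hTPP d ρ f hf hmem
  have hres' : TensorRestrictsTo (matMulDirectSum ℂ d d d)
      (matMulTensor ℂ X.card Y.card Z.card) := by
    refine hres.trans ?_
    have key : matMulTensor ℂ X.card Y.card Z.card = fun a b c => matMulTensorOn ℂ X Y Z
        (Prod.map X.equivFin.symm Z.equivFin.symm a) (Prod.map X.equivFin.symm Y.equivFin.symm b)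
        (Prod.map Y.equivFin.symm Z.equivFin.symm c) := by
      funext a b c
      exact (matMulTensorOn_reindex (K := ℂ) X.equivFin.symm Y.equivFin.symm Z.equivFin.symm
        a b c).symm
    rw [key]
    exact tensorRestrictsTo_precomp _ _ _ _
  exact rpow_omega_le_sum_rpow_of_restrictsTo d hr hres'

/-- For inverse-closed `X, Y, Z` (e.g. subgroups, or finite subsets `S` of subgroups enlarged to
`S ∪ S⁻¹`), the right-quotient triple product property (Cohn–Umans 2003, Def. 2.1 = the source's
§1 = the tree's `TripleProductProperty`) implies the embedding form used by Thm. 2.2: from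
`x y⁻¹ y' z⁻¹ = x' z'⁻¹` apply the TPP to `x'⁻¹ (x⁻¹)⁻¹ · y⁻¹ (y'⁻¹)⁻¹ · z⁻¹ (z'⁻¹)⁻¹ = 1`.
[cite: BlasiakCohnGrochowPrattUmans2024, §1 (TPP, p. 2)] -/
theorem tpp_embedding_of_tripleProductProperty_of_inv_mem {G : Type u} [Group G]
    {X Y Z : Finset G} (h : Literature.Combinatorics.Additive.TripleProductProperty X Y Z)
    (hX : ∀ x ∈ X, x⁻¹ ∈ X) (hY : ∀ y ∈ Y, y⁻¹ ∈ Y) (hZ : ∀ z ∈ Z, z⁻¹ ∈ Z) :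
    ∀ x ∈ X, ∀ x' ∈ X, ∀ y ∈ Y, ∀ y' ∈ Y, ∀ z ∈ Z, ∀ z' ∈ Z,
      x * y⁻¹ * y' * z⁻¹ = x' * z'⁻¹ → x = x' ∧ y = y' ∧ z = z' := by
  intro x hx x' hx' y hy y' hy' z hz z' hz' he
  have key : x'⁻¹ * x⁻¹⁻¹ * (y⁻¹ * y'⁻¹⁻¹) * (z⁻¹ * z'⁻¹⁻¹) = 1 := by
    have := congrArg (fun w => x'⁻¹ * w * z') he
    simp only [mul_assoc, inv_mul_cancel_left, inv_mul_cancel] at this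
    simpa only [inv_inv, mul_assoc] using this
  obtain ⟨h1, h2, h3⟩ := h _ (hX x' hx') _ (hX x hx) _ (hY y hy) _ (hY y' hy') _ (hZ z hz) _
    (hZ z' hz') key
  exact ⟨(inv_injective h1).symm, inv_injective h2, inv_injective h3⟩

/-- **BCGPU 2024, Theorem 2.2 — CORRECTED STATEMENT** (see the module docstring). Verbatim the
printed theorem — "Let `G` be a group (not necessarily finite), with finite subsets `X, Y, Z`
satisfying the TPP. If `R_sep` is a finite set of finite-dimensional complex representations of `G`
such that `RepFun(R_sep)` contains a set of separating functions for `(X, Y, Z)`, then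
`(|X||Y||Z|)^{ω/3} ≤ ∑_{ρ ∈ R_sep} (dim ρ)^ω`" — with `R_sep` a finite family
`ρ i : G →* GL_{n i}(ℂ)`, separating functions as in Def. 2.1 (`IsSeparatingFamily`), `RepFun` =
`repFun`, `ω = omega ℂ`, EXCEPT that "satisfying the TPP" is rendered in the EMBEDDING form that the
printed proof uses through eq. (2.1) — `x y⁻¹ y' z⁻¹ = x' z'⁻¹ ⟹ x = x', y = y', z = z'`, spelled
exactly as in the `MatrixMultiplication` route items — instead of the right-quotient form of the
paper's §1 (the tree's `TripleProductProperty`, used by the sibling fact `BCGPU2024_thm_2_2`, which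
is thereby false in non-abelian groups: `BCGPU2024_thm_2_2_false`,
`BCGPUInfiniteGroupsCounterexample.lean`). The two forms agree in abelian groups and for
inverse-closed `X, Y, Z` (e.g. subgroups), and either form passes to subsets; the source verifies
the embedding form for its own constructions (proof of Lemma 2.11, p. 22). Discharged below.
[cite: BlasiakCohnGrochowPrattUmans2024, Thm. 2.2] -/
def BCGPU2024_thm_2_2_corrected : Prop :=
  ∀ (G : Type u) [Group G] (X Y Z : Finset G),
    (∀ x ∈ X, ∀ x' ∈ X, ∀ y ∈ Y, ∀ y' ∈ Y, ∀ z ∈ Z, ∀ z' ∈ Z,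
      x * y⁻¹ * y' * z⁻¹ = x' * z'⁻¹ → x = x' ∧ y = y' ∧ z = z') →
    ∀ (ι : Type) [Fintype ι] (n : ι → ℕ) (ρ : ∀ i, G →* Matrix.GeneralLinearGroup (Fin (n i)) ℂ)
      (f : G → G → (G → ℂ)), IsSeparatingFamily X Y Z f → (∀ x ∈ X, ∀ z ∈ Z, f x z ∈ repFun n ρ) →
      ((X.card * Y.card * Z.card : ℕ) : ℝ) ^ (omega ℂ / 3) ≤ ∑ i, ((n i : ℕ) : ℝ) ^ omega ℂ

/-- DISCHARGE of `BCGPU2024_thm_2_2_corrected` — **BCGPU 2024, Thm. 2.2** (TPP in embedding form):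
drop the zero-dimensional representations, enumerate the rest, and apply
`card_rpow_omega_le_sum_rpow` (eq. (2.2) + tensor power trick).
[cite: BlasiakCohnGrochowPrattUmans2024, Thm. 2.2] -/
theorem BCGPU2024_thm_2_2_corrected_holds : BCGPU2024_thm_2_2_corrected := by
  intro G _ X Y Z hTPP ι _ n ρ f hf hmem
  classical
  -- drop the zero-dimensional representations and enumerate the others
  let eqv : {i : ι // n i ≠ 0} ≃ Fin (Fintype.card {i : ι // n i ≠ 0}) := Fintype.equivFin _
  let e : Fin (Fintype.card {i : ι // n i ≠ 0}) → ι := fun j => (eqv.symm j).1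
  have he : ∀ i, n i ≠ 0 → ∃ j, e j = i := fun i hi =>
    ⟨eqv ⟨i, hi⟩, by show (eqv.symm (eqv ⟨i, hi⟩)).1 = i; rw [Equiv.symm_apply_apply]⟩
  haveI : ∀ j, NeZero ((n ∘ e) j) := fun j => ⟨(eqv.symm j).2⟩
  have hmem' : ∀ x ∈ X, ∀ z ∈ Z, f x z ∈ repFun (n ∘ e) (fun j => ρ (e j)) := fun x hx z hz =>
    repFun_le_repFun_comp n ρ e he (hmem x hx z hz)
  refine (card_rpow_omega_le_sum_rpow X Y Z hTPP (n ∘ e) (fun j => ρ (e j)) f hf hmem').trans ?_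
  have hsub : ∑ i ∈ Finset.univ.filter (fun i => n i ≠ 0), ((n i : ℕ) : ℝ) ^ omega ℂ =
      ∑ i' : {i : ι // n i ≠ 0}, ((n i'.1 : ℕ) : ℝ) ^ omega ℂ :=
    Finset.sum_subtype (p := fun i => n i ≠ 0) _ (fun i => by simp) (fun i => ((n i : ℕ) : ℝ) ^ omega ℂ)
  calc ∑ j, (((n ∘ e) j : ℕ) : ℝ) ^ omega ℂ = ∑ i' : {i : ι // n i ≠ 0}, ((n i'.1 : ℕ) : ℝ) ^ omega ℂ :=
        Fintype.sum_equiv eqv.symm _ _ fun j => rfl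
    _ = ∑ i ∈ Finset.univ.filter (fun i => n i ≠ 0), ((n i : ℕ) : ℝ) ^ omega ℂ := hsub.symm
    _ ≤ ∑ i, ((n i : ℕ) : ℝ) ^ omega ℂ :=
        Finset.sum_le_univ_sum_of_nonneg fun i => Real.rpow_nonneg (Nat.cast_nonneg _) _

/-- The printed "In particular" clause of Thm. 2.2: "for `D = ∑_ρ (dim ρ)²` and
`d_max = max dim ρ`, `(|X||Y||Z|)^{ω/3} ≤ D · d_max^{ω−2}`" — here with any common bound `d ≥ 1` of
the dimensions in place of `d_max` (from the theorem, `∑ dᵢ^ω ≤ (∑ dᵢ²) d^{ω−2}` as `ω ≥ 2`).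
[cite: BlasiakCohnGrochowPrattUmans2024, Thm. 2.2 ("In particular")] -/
theorem BCGPU2024_thm_2_2_corrected.le_mul_rpow (h : BCGPU2024_thm_2_2_corrected.{u})
    {G : Type u} [Group G] {X Y Z : Finset G}
    (hTPP : ∀ x ∈ X, ∀ x' ∈ X, ∀ y ∈ Y, ∀ y' ∈ Y, ∀ z ∈ Z, ∀ z' ∈ Z,
      x * y⁻¹ * y' * z⁻¹ = x' * z'⁻¹ → x = x' ∧ y = y' ∧ z = z')
    {ι : Type} [Fintype ι] {n : ι → ℕ} (ρ : ∀ i, G →* Matrix.GeneralLinearGroup (Fin (n i)) ℂ)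
    {f : G → G → (G → ℂ)} (hf : IsSeparatingFamily X Y Z f)
    (hmem : ∀ x ∈ X, ∀ z ∈ Z, f x z ∈ repFun n ρ) {d : ℕ} (hd : 1 ≤ d) (hn : ∀ i, n i ≤ d) :
    ((X.card * Y.card * Z.card : ℕ) : ℝ) ^ (omega ℂ / 3) ≤
      (∑ i, ((n i : ℕ) : ℝ) ^ 2) * (d : ℝ) ^ (omega ℂ - 2) :=
  (h G X Y Z hTPP ι n ρ f hf hmem).trans (sum_rpow_omega_le_of_le n hd hn (omega_two_le (K := ℂ)))

end Main

end Literature.Computability.AlgebraicComplexity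

end
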